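import Mathlib
import Summits.Parity.BatemanHorn.Theses.SelbergDelangeRigidity

/-!
# Sketch — crux-ideate stmt-Parity-9770 (`SelbergDelangeRigidity.LSDRealSegment`), ideator 2, round 1

First lemmas of the two idea cards (statements only; they must elaborate, not be proved).
-/

namespace Summit.Parity.BatemanHorn.Cruxes.LSDRealSegment.Ideator2

open Filter Polynomial Finset
open scoped BigOperators Topology Classical

/-- Card `product-anatomy-subcritical`, delta (a): for the UNCAPPED statistic the system statistic is the
Ω of the product polynomial, exactly (complete additivity of `Ω`), whenever all values are positive —
no resultant / common-prime corrections (contrast the capped statistic of stmt-11292). Provable now. -/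
def OmegaProductExact : Prop :=
  ∀ (k : ℕ) (f : Fin k → Polynomial ℤ) (n : ℕ), (∀ i, 0 < (f i).eval (n : ℤ)) →
    (∑ i, ArithmeticFunction.cardFactors (((f i).eval (n : ℤ)).toNat)) =
      ArithmeticFunction.cardFactors ((∏ i, (f i).eval (n : ℤ)).toNat)

/-- Card `product-anatomy-subcritical`, first stub: top-class truncation for the uncapped product statistic
(the y-tilted mass of `n ≤ x` such that some `f_i(n)` has a prime factor `> x^{deg f_i - η}` is `≤ ε`-fraction of
the main term; upper-bound sieve of the right order, no asymptotics). -/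
def TopClassTruncationOmega : Prop :=
  ∀ (k : ℕ) (f : Fin k → Polynomial ℤ), Literature.NumberTheory.Sieve.IsBatemanHornSystem f →
    ∀ y : ℝ, 1 ≤ y → y < 2 → ∀ ε : ℝ, 0 < ε → ∃ η : ℝ, 0 < η ∧
      ∀ᶠ x : ℕ in atTop,
        (∑ n ∈ (Finset.Icc 1 x).filter (fun n : ℕ => ∃ i : Fin k, ∃ p : ℕ, p.Prime ∧
            (p : ℤ) ∣ (f i).eval (n : ℤ) ∧ (x : ℝ) ^ (((f i).natDegree : ℝ) - η) < p),
          y ^ (∑ i, ArithmeticFunction.cardFactors (((f i).eval (n : ℤ)).toNat)))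
        ≤ ε * x * Real.log x ^ ((k : ℝ) * (y - 1))

/-- Card `montgomery-rows-all-degrees`, first checkable row: the ONE-POINT LAW AT ALL SIZES for a single
Bateman–Horn polynomial `g` — the number of pairs `(n, p)`, `1 ≤ n ≤ x`, `p` prime in `(x^θ₁, x^θ₂]`,
`p ∣ g(n)`, is `~ x log(θ₂/θ₁)` for every `1 ≤ θ₁ < θ₂ < deg g`. For `θ₂ ≤ 2` this is the sibling crux's
`PrimeRootCountSubcritical`; for `deg g ≥ 3` and `θ₂ > 2` the row is SUPER-critical (scale `x/p < p^{-1/2}`). -/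
def PrimeRowAllSizes (g : Polynomial ℤ) : Prop :=
  ∀ θ₁ θ₂ : ℝ, 1 ≤ θ₁ → θ₁ < θ₂ → θ₂ < (g.natDegree : ℝ) →
    Tendsto (fun x : ℕ =>
      ((((Finset.Icc 1 x) ×ˢ ((Finset.range (⌊(x : ℝ) ^ θ₂⌋₊ + 1)).filter
          (fun p : ℕ => p.Prime ∧ (x : ℝ) ^ θ₁ < (p : ℝ)))).filter
          (fun np : ℕ × ℕ => (np.2 : ℤ) ∣ g.eval (np.1 : ℤ))).card : ℝ) / (x : ℝ))
      atTop (𝓝 (Real.log (θ₂ / θ₁)))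

/-- The all-degree hypothesis in its cleanest typed instance (single polynomial, prime moduli, first moment,
signed — no absolute values): `RootMH₁ g` := `PrimeRowAllSizes g`. The structured-moduli version (products of
`r` primes in boxes times a smooth modulus, with smooth twists) is what the line consumes; see the card. -/
def RootMH₁ : Prop :=
  ∀ g : Polynomial ℤ, Literature.NumberTheory.Sieve.IsBatemanHornSystem ![g] → PrimeRowAllSizes g

end Summit.Parity.BatemanHorn.Cruxes.LSDRealSegment.Ideator2
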